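import Summits.QuantumFields.YangMills.Theorems.BalabanUVNodesN21BranchRefinedInserts

/-!
# N21 (NE7c) — module 38g «BRANCH QUOTIENT BRACKETS» (LENS nearmiss v23.0 ROW P‴, Card 66; Sketch-g23 §Q): on the (1.88)-branch, 38c's
# exterior-uniform quotient bound `hquotA` IS two exterior-free BRACKETS and a CANCELLATION of the background action — typed down to the
# junction with 38e∕38c (§2) and to the Boltzmann form in the tower's own currency (§3), with an A6 witness (§4)

PROVENANCE AND CREDIT.  §1 is the planner seat `ym-lens-BalabanUVNodes-nearmiss`'s `Sketch-nearmiss-g23.lean` §Q (typed companion of `LENS-nearmiss.md`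
v23.0, Card 66, FAN-OUT ROW P‴ «first refusal on a part 38g `…/BalabanUVNodesN21BranchQuotientBrackets.lean` = Sketch-g23 §Q VERBATIM WITH CREDIT
(7 lemmas; `hq_of_brackets` feeds 38e's `hq_of_branch` restricted form) + a docstring naming the three located statements that replace the opaque
`q_□`»; sketch sha16 0b93b0afd502e9fc, farm rc 0) landed VERBATIM by seat `pub-ymgap-dag-n21-e` (g13): authorship of §1 = the lens; §2–§4 are the
filer's own hand.  Lane `--kind proof --supports stmt-QuantumFields-20544 --as helper` (K3⁷ `SpineGivenEndpointR13SepCoPH`); count-neutral.  Consumer: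
the record INSTANCE of 38c `…N21HistoriesHybridLiftTower.shellWeightBound_histories_of_liftedDensities` (t23 pen) — its binder `hquotA` on the
(1.88)-REFINED sent family (38d header, 38e), per sent component, with `s` = 38c's `O ∪ F s`.

THE LENS'S WHY (Card 66, abridged) AND WHAT §2–§4 ADD.  38c–38f display NODE O's single-component bound as ONE opaque number `q` per sent
component.  Print computes it as a QUOTIENT ([LF-II] (1.1)–(1.2) pp. 356–357: numerator = the term with its large-field letters at `Γ`, denominator =
the small-field WINDOW integral around the background `U₀`) whose huge exterior-dependent part `A(U₀(V))∕g_k²` «has to be cancelled … otherwise we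
will not get good bounds» (p. 358).  §1 (lens): with a NORMALISER `N` reading the exterior only (`IndepOf s N`), a NUMERATOR BRACKET `∫_s b ≤ q₁`
(`a ≤ N·b`) and a DENOMINATOR BRACKET `v₀ ≤ ∫_s w` (`N·w ≤ ins` on the branch `{φ ≠ 0}`, (1.89)) give `q = q₁∕v₀` — `N` CANCELS (`hq_of_brackets`;
two backgrounds `N₁ ≤ B·N₀`: `hq_of_brackets_cmp`); on one fibre law with density `e^{−f}` the brackets are two SUP-INEQUALITIES for the action and
`quotient_after_cancellation` displays `∫_S e^{−f} ≤ e^{η−G}(νS∕νW)∫_W e^{−f}`, `E₀` gone.  §2 (own) THE JUNCTION: through `hq_of_brackets` and 38e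
`hq_of_branch` the brackets give 38c's `hquotA` IN ITS LITERAL SHAPE on the refined pair, `∀ V, ∫⋯∫⁻_s (φ·a) ≤ (q₁∕v₀)·∫⋯∫⁻_s (φ·ins)`
(`hquot_of_brackets`, `hquot_of_brackets_cmp`), and Card 64's receiver-insert edition via 38e `hq_receiver_of_window` (`hquot_receiver_of_brackets`,
`q = (q₁∕v₀)·B′`).  §3 (own) THE CANCELLATION IN THE TOWER'S CURRENCY: the one-fibre-law cancellation re-typed for `lmarginal` with
EXTERIOR-DEPENDENT background actions `E₀, E₁ : (Π i, X i) → ℝ` reading no fibre coordinate — `boltzmann_numerator_bracket` (`a ≤ e^{−f}·𝟙_S`,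
`E₁ + G ≤ f` on `S`, fibre volumes of `S` `≤ vS` ⇒ `N = e^{−E₁}`, `q₁ = e^{−G}·vS`), `boltzmann_denominator_bracket` (`e^{−fI}·𝟙_W ≤ ins` on the branch,
`fI ≤ E₀ + η` on `W`, fibre volumes of `W` `≥ vW` ⇒ `v₀ = e^{−η}·vW`), END-TO-END `hquot_of_actionBrackets_cmp` ∕ `hquot_of_actionBrackets`: 38c's
`hquotA` shape on the refined pair with `q = e^{η+β−G}·(vS∕vW)` — `E₀(V)`, `E₁(V)` NEVER ENTER `q`.  §4 A6 WITNESS (STANDING A6 RULE №189 (3)):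
§3's END theorem APPLIED to one-coordinate toy data, every binder discharged in the kernel (`actionBrackets_binders_inhabited`).

THE THREE LOCATED STATEMENTS THAT REPLACE THE OPAQUE `q_□` (ROW P‴'s ask; NODE O's content, DISPLAYED as §3's binders `hgap`∕`hall`∕`hcmp`, never
discharged here): (1) CONSTRAINED ACTION GAP — on the sender's support, relative to the receiver's background, the effective action exceeds the
background action by `G ≥ c·p₀(g_k)²·|Γ|`: [LF-II] (1.13)–(1.22) pp. 359–362 (quadratic form (1.21) «bounded by 0», linear term by comparing `U_{k,Z}`
with `U₀`) + the letters' gain [V] p. 381 (per large plaquette `exp(−¼g⁻²K⁻¹ε_k²) ≤ exp(−A₁²p₀(g_k)²)`, `B15Chi175` header); in-tree SPECIES = the K0⁷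
variational engine ([15] Thm 1 ∕ Prop 4: `…K0VariationalThm1C1Floor`, `…Thm1ScaledCorner*`, `…Thm1OuterRange`) — cited, NOT consumed; (2) WINDOW
ALLOWANCE — on the small-field window the action is within `η ≤ O(1) log M·|Λ_Γ|` of the background action: [LF-II] (1.7)–(1.11) pp. 358–359 ((1.10),
(1.11) `|I(U₀)| ≤ O(1) log M·|Λ| ≤ O(1)M⁵`; p. 358 «bounded from below by exp(−O(1)|Λ|) = exp(−O(M⁴))»); (3) TWO-BACKGROUND CONSTANT — the actions of
the sender's background `U_{k,Z}` and the receiver's `U₀` differ on the branch by a bounded boundary term `β` (`B = e^β`): [LF-II] p. 369 ll. 5–11 +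
(1.49) («boundedness only» is for `B`∕`C_k`, NOT for `q` — lens census (nnnnnnn)).  HONEST RIDER (lens KT-66 (i)): print LAPLACE-REFINES (1)–(2) —
both brackets are Gaussian-type integrals whose fluctuation volumes cancel up to (1.11)'s `e^{O(1) log M·|Λ|}`; with SUP-bounds only `vS∕vW` is beaten
by `e^{−G}` only in print's regime `g_k ≤ g₀(M)`: the sup-form below is the typed CARICATURE of the mechanism, (1.11) the displayed input.

HONEST FRAMING.  [textbook]∕[folklore] measure theory on finite products (Mathlib `lmarginal`, b01 `IndepOf`) and on a general measure space, real
arithmetic; 0 def, 0 sorry; NOTHING of Bałaban's is asserted ([LF-II] (1.1)–(1.22) pp. 356–362, (1.49) p. 369, [IV] (1.88)∕(1.89) pp. 197–198 are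
CONTEXT and LOCATORS for displayed binders); the sup-inequalities and the background comparison ARE NODE O's content, NOT discharged; `q₁`, `v₀`,
`vS`, `vW`, `G`, `η`, `β` are DISPLAYED, never estimated; NE7c ((M1) at the live slots) is NOT PRINTED and NOT PROVED; N21 NOT discharged;
count-neutral; one finite 𝕋⁴ at fixed ε — nothing about ℝ⁴ ∕ OS ∕ mass gap ∕ Clay.

CITATION HEADER (lean-in-tree rule).  BY NAME: 38e `N21BranchRefinedInserts.hq_of_branch` ∕ `hq_receiver_of_window`; b01 `B15.BasicStep.IndepOf` ∕
`lmarginal_mul_of_indepOf`; Mathlib `lmarginal`, `lmarginal_mono`, `lmarginal_univ`, `setLIntegral_mono'`, `setLIntegral_const`, `ENNReal.div_mul_cancel`,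
`ENNReal.mul_div_mul_comm`, `ENNReal.ofReal_div_of_pos`, `Real.exp_add`∕`Real.exp_sub`.  Context: 38c (binder `hquotA`), 38d (refined-family reading),
38f `charge_le_of_liveWindow` (`q̄ := q·B`).
-/

set_option autoImplicit false

open MeasureTheory Set Function
open scoped ENNReal NNReal

namespace Summit.QuantumFields.YangMills.Theorems.N21BranchQuotientBrackets

/-! ## §1  LENS Sketch-g23 §Q VERBATIM (Card 66) — brackets: on the branch `hquotA` = numerator bracket ∕ denominator bracket, background cancelled -/

section Brackets

variable {ι : Type*} [DecidableEq ι] {X : ι → Type*} [∀ i, MeasurableSpace (X i)] (μ : ∀ i, Measure (X i))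

open Literature.MathematicalPhysics.QuantumFieldTheory.Balaban1983to89.B15.BasicStep

variable {μ} in
/-- **NUMERATOR BRACKET.**  If the sent density is dominated by an exterior normaliser times a profile, `a ≤ N·b` with
`IndepOf s N` (`N V = exp(−A(U₀(V))∕g²)`, the background action of the receiver's exterior datum), and the profile's
fibre integral is exterior-uniformly small, `∫_s b ≤ q₁` (large-field gain × fluctuation volume, [LF-II] (1.14)–(1.22)),
then `∫_s a ≤ q₁·N` for EVERY exterior. [folklore] -/
theorem numerator_bracket (s : Finset ι) {N a b : (∀ i, X i) → ℝ≥0∞} (hN : IndepOf s N) (hb : Measurable b)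
    (ha : ∀ V, a V ≤ N V * b V) {q₁ : ℝ≥0∞} (hq₁ : ∀ V, (∫⋯∫⁻_s, b ∂μ) V ≤ q₁) :
    ∀ V, (∫⋯∫⁻_s, a ∂μ) V ≤ q₁ * N V := by
  intro V
  calc (∫⋯∫⁻_s, a ∂μ) V ≤ (∫⋯∫⁻_s, N * b ∂μ) V := lmarginal_mono (fun W => ha W) V
    _ = N V * (∫⋯∫⁻_s, b ∂μ) V := by rw [lmarginal_mul_of_indepOf s hN hb, Pi.mul_apply]
    _ ≤ N V * q₁ := by gcongr; exact hq₁ V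
    _ = q₁ * N V := mul_comm _ _

variable {μ} in
/-- **DENOMINATOR BRACKET.**  If ON THE BRANCH `{φ ≠ 0}` the insert dominates the normaliser times a window profile,
`N·w ≤ ins` (the window around the background is NESTED in the receiver's small-field fibre, [IV] (1.89)), and the window
profile's fibre integral is exterior-uniformly FAT, `v₀ ≤ ∫_s w` ([LF-II] (1.2)–(1.11): the constrained fluctuation
integral is `≥ exp(−O(1) log M·|Λ|)` after the background action is taken out), then `N·v₀ ≤ ∫_s ins` on the branch.
[folklore] -/
theorem denominator_bracket (s : Finset ι) {φ N w ins : (∀ i, X i) → ℝ≥0∞} (hφ : IndepOf s φ) (hN : IndepOf s N)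
    (hw : Measurable w) (hins : ∀ V, φ V ≠ 0 → N V * w V ≤ ins V) {v₀ : ℝ≥0∞}
    (hv : ∀ V, φ V ≠ 0 → v₀ ≤ (∫⋯∫⁻_s, w ∂μ) V) :
    ∀ V, φ V ≠ 0 → N V * v₀ ≤ (∫⋯∫⁻_s, ins ∂μ) V := by
  intro V hV
  calc N V * v₀ ≤ N V * (∫⋯∫⁻_s, w ∂μ) V := by gcongr; exact hv V hV
    _ = (∫⋯∫⁻_s, N * w ∂μ) V := by rw [lmarginal_mul_of_indepOf s hN hw, Pi.mul_apply]
    _ ≤ (∫⋯∫⁻_s, ins ∂μ) V := by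
        simp only [lmarginal]
        exact lintegral_mono fun y => hins _ (by rw [hφ V y]; exact hV)

/-- **`hquot` FROM THE TWO BRACKETS** — the normaliser cancels: `∫_s a ≤ (q₁ ∕ v₀)·∫_s ins` on the branch. [folklore] -/
theorem hq_of_brackets {V : Type*} {φ N A I : V → ℝ≥0∞} {q₁ v₀ : ℝ≥0∞} (hv₀ : v₀ ≠ 0) (hv₀' : v₀ ≠ ⊤)
    (hnum : ∀ V, A V ≤ q₁ * N V) (hden : ∀ V, φ V ≠ 0 → N V * v₀ ≤ I V) :
    ∀ V, φ V ≠ 0 → A V ≤ q₁ / v₀ * I V := by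
  intro V hV
  calc A V ≤ q₁ * N V := hnum V
    _ = q₁ / v₀ * (N V * v₀) := by
        rw [show q₁ / v₀ * (N V * v₀) = q₁ / v₀ * v₀ * N V by ring, ENNReal.div_mul_cancel hv₀ hv₀']
    _ ≤ q₁ / v₀ * I V := by gcongr; exact hden V hV

/-- **TWO BACKGROUNDS** (print compares the sender's background `U_{k,Z}` with the receiver's `U₀`, [LF-II] (1.22) ff.):
if the numerator is normalised by `N₁`, the denominator by `N₀`, and `N₁ ≤ B·N₀` on the branch (Wilson actions of the two
backgrounds differ by a bounded boundary term, p. 369 «boundedness only»), then `q = q₁·B ∕ v₀`. [folklore] -/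
theorem hq_of_brackets_cmp {V : Type*} {φ N₀ N₁ A I : V → ℝ≥0∞} {q₁ v₀ B : ℝ≥0∞} (hv₀ : v₀ ≠ 0) (hv₀' : v₀ ≠ ⊤)
    (hnum : ∀ V, A V ≤ q₁ * N₁ V) (hcmp : ∀ V, φ V ≠ 0 → N₁ V ≤ B * N₀ V)
    (hden : ∀ V, φ V ≠ 0 → N₀ V * v₀ ≤ I V) :
    ∀ V, φ V ≠ 0 → A V ≤ q₁ * B / v₀ * I V := by
  intro V hV
  calc A V ≤ q₁ * N₁ V := hnum V
    _ ≤ q₁ * (B * N₀ V) := by gcongr; exact hcmp V hV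
    _ = q₁ * B / v₀ * (N₀ V * v₀) := by
        rw [show q₁ * B / v₀ * (N₀ V * v₀) = q₁ * B / v₀ * v₀ * N₀ V by ring, ENNReal.div_mul_cancel hv₀ hv₀']
        ring
    _ ≤ q₁ * B / v₀ * I V := by gcongr; exact hden V hV

end Brackets

section Cancellation

variable {Ω : Type*} [MeasurableSpace Ω] (ν : Measure Ω)

/-- a SUP-inequality for the action on a set bounds the Boltzmann integral from ABOVE. [textbook] -/
theorem setLIntegral_exp_neg_le_of_ge {S : Set Ω} (hS : MeasurableSet S) {f : Ω → ℝ} {E : ℝ}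
    (h : ∀ x ∈ S, E ≤ f x) :
    ∫⁻ x in S, ENNReal.ofReal (Real.exp (-f x)) ∂ν ≤ ENNReal.ofReal (Real.exp (-E)) * ν S := by
  calc ∫⁻ x in S, ENNReal.ofReal (Real.exp (-f x)) ∂ν ≤ ∫⁻ _ in S, ENNReal.ofReal (Real.exp (-E)) ∂ν :=
        setLIntegral_mono' hS fun x hx =>
          ENNReal.ofReal_le_ofReal (Real.exp_le_exp.mpr (neg_le_neg (h x hx)))
    _ = ENNReal.ofReal (Real.exp (-E)) * ν S := setLIntegral_const _ _

/-- an INF-inequality for the action on a window bounds the Boltzmann integral from BELOW. [textbook] -/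
theorem setLIntegral_exp_neg_ge_of_le {W : Set Ω} (hW : MeasurableSet W) {f : Ω → ℝ} {E : ℝ}
    (h : ∀ x ∈ W, f x ≤ E) :
    ENNReal.ofReal (Real.exp (-E)) * ν W ≤ ∫⁻ x in W, ENNReal.ofReal (Real.exp (-f x)) ∂ν := by
  calc ENNReal.ofReal (Real.exp (-E)) * ν W = ∫⁻ _ in W, ENNReal.ofReal (Real.exp (-E)) ∂ν :=
        (setLIntegral_const _ _).symm
    _ ≤ ∫⁻ x in W, ENNReal.ofReal (Real.exp (-f x)) ∂ν :=
        setLIntegral_mono' hW fun x hx =>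
          ENNReal.ofReal_le_ofReal (Real.exp_le_exp.mpr (neg_le_neg (h x hx)))

/-- **THE BACKGROUND ACTION CANCELS IN THE QUOTIENT** ([LF-II] p. 358 bottom).  If the action is `≥ E₀ + G` on the
sender's support `S` (background action PLUS the large-field gain: the quadratic form (1.21) is nonnegative and a large
plaquette costs `G ≍ p₀(g_k)²`) and `≤ E₀ + η` on a window `W` around the background ((1.7)–(1.11): `η = O(1) log M·|Λ|`),
then `∫_S e^{−f} ≤ e^{η − G}·(ν S ∕ ν W)·∫_W e^{−f}` — the exterior-dependent and unboundedly large `E₀ = A(U₀(V))∕g²`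
is GONE; what remains is the gain against a window-volume and a boundary-term allowance. [folklore] -/
theorem quotient_after_cancellation {S W : Set Ω} (hS : MeasurableSet S) (hW : MeasurableSet W) {f : Ω → ℝ}
    {E₀ G η : ℝ} (hnum : ∀ x ∈ S, E₀ + G ≤ f x) (hden : ∀ x ∈ W, f x ≤ E₀ + η) (hW0 : ν W ≠ 0) (hWtop : ν W ≠ ⊤) :
    ∫⁻ x in S, ENNReal.ofReal (Real.exp (-f x)) ∂ν
      ≤ ENNReal.ofReal (Real.exp (η - G)) * (ν S / ν W) * ∫⁻ x in W, ENNReal.ofReal (Real.exp (-f x)) ∂ν := by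
  have key : ENNReal.ofReal (Real.exp (-(E₀ + G)))
      = ENNReal.ofReal (Real.exp (η - G)) * ENNReal.ofReal (Real.exp (-(E₀ + η))) := by
    rw [← ENNReal.ofReal_mul (Real.exp_pos _).le, ← Real.exp_add]
    congr 2
    ring
  calc ∫⁻ x in S, ENNReal.ofReal (Real.exp (-f x)) ∂ν ≤ ENNReal.ofReal (Real.exp (-(E₀ + G))) * ν S :=
        setLIntegral_exp_neg_le_of_ge ν hS hnum
    _ = ENNReal.ofReal (Real.exp (η - G)) * (ν S / ν W) * (ENNReal.ofReal (Real.exp (-(E₀ + η))) * ν W) := by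
        rw [key, show ENNReal.ofReal (Real.exp (η - G)) * (ν S / ν W) * (ENNReal.ofReal (Real.exp (-(E₀ + η))) * ν W)
            = ENNReal.ofReal (Real.exp (η - G)) * ENNReal.ofReal (Real.exp (-(E₀ + η))) * (ν S / ν W * ν W) by ring,
          ENNReal.div_mul_cancel hW0 hWtop]
    _ ≤ ENNReal.ofReal (Real.exp (η - G)) * (ν S / ν W) * ∫⁻ x in W, ENNReal.ofReal (Real.exp (-f x)) ∂ν := by
        gcongr
        exact setLIntegral_exp_neg_ge_of_le ν hW hden

end Cancellation

/-! ## §2  (own hand) THE JUNCTION TO 38e∕38c — the brackets give 38c's `hquotA` in its literal shape on the (1.88)-refined pair -/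

section Junction

variable {ι : Type*} [DecidableEq ι] {X : ι → Type*} [∀ i, MeasurableSpace (X i)] (μ : ∀ i, Measure (X i))

open Literature.MathematicalPhysics.QuantumFieldTheory.Balaban1983to89.B15.BasicStep
open Summit.QuantumFields.YangMills.Theorems.N21BranchRefinedInserts

variable {μ} in
/-- **`hquotA` FROM THE TWO BRACKETS.**  Numerator bracket (`a ≤ N·b`, `∫_s b ≤ q₁ ∀V`) and denominator bracket (on the branch
`{φ ≠ 0}`: `N·w ≤ ins`, `v₀ ≤ ∫_s w`, `0 < v₀ < ∞`), `N` and `φ` reading the exterior only, give 38c's binder `hquotA` LITERALLY on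
the refined pair `(φ·a, φ·ins)`, for EVERY exterior: `∫⋯∫⁻_s (φ·a) ≤ (q₁∕v₀)·∫⋯∫⁻_s (φ·ins)` — `hq_of_brackets` (the normaliser
cancels) then 38e `hq_of_branch` (the branch factor passes through the marginal); `s` = 38c's `O ∪ F s`. [folklore] -/
theorem hquot_of_brackets (s : Finset ι) {φ N a b w ins : (∀ i, X i) → ℝ≥0∞} {q₁ v₀ : ℝ≥0∞}
    (hφ : IndepOf s φ) (hN : IndepOf s N) (ha : Measurable a) (hb : Measurable b) (hw : Measurable w)
    (hins : Measurable ins) (hab : ∀ V, a V ≤ N V * b V) (hq₁ : ∀ V, (∫⋯∫⁻_s, b ∂μ) V ≤ q₁)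
    (hwins : ∀ V, φ V ≠ 0 → N V * w V ≤ ins V) (hv : ∀ V, φ V ≠ 0 → v₀ ≤ (∫⋯∫⁻_s, w ∂μ) V)
    (hv₀ : v₀ ≠ 0) (hv₀' : v₀ ≠ ⊤) :
    ∀ V, (∫⋯∫⁻_s, φ * a ∂μ) V ≤ q₁ / v₀ * (∫⋯∫⁻_s, φ * ins ∂μ) V :=
  hq_of_branch s hφ ha hins
    (hq_of_brackets hv₀ hv₀' (numerator_bracket s hN hb hab hq₁) (denominator_bracket s hφ hN hw hwins hv))

variable {μ} in
/-- **`hquotA` FROM THE TWO BRACKETS, TWO BACKGROUNDS** ([LF-II] (1.22) ff., p. 369): numerator normalised by `N₁` (the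
sender's background), denominator by `N₀` (the receiver's), `N₁ ≤ B·N₀` on the branch ⇒ `hquotA` on the refined pair with
`q = q₁·B∕v₀`. [folklore] -/
theorem hquot_of_brackets_cmp (s : Finset ι) {φ N₀ N₁ a b w ins : (∀ i, X i) → ℝ≥0∞} {q₁ v₀ B : ℝ≥0∞}
    (hφ : IndepOf s φ) (hN₀ : IndepOf s N₀) (hN₁ : IndepOf s N₁) (ha : Measurable a) (hb : Measurable b)
    (hw : Measurable w) (hins : Measurable ins)
    (hab : ∀ V, a V ≤ N₁ V * b V) (hq₁ : ∀ V, (∫⋯∫⁻_s, b ∂μ) V ≤ q₁)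
    (hcmp : ∀ V, φ V ≠ 0 → N₁ V ≤ B * N₀ V)
    (hwins : ∀ V, φ V ≠ 0 → N₀ V * w V ≤ ins V) (hv : ∀ V, φ V ≠ 0 → v₀ ≤ (∫⋯∫⁻_s, w ∂μ) V)
    (hv₀ : v₀ ≠ 0) (hv₀' : v₀ ≠ ⊤) :
    ∀ V, (∫⋯∫⁻_s, φ * a ∂μ) V ≤ q₁ * B / v₀ * (∫⋯∫⁻_s, φ * ins ∂μ) V :=
  hq_of_branch s hφ ha hins
    (hq_of_brackets_cmp hv₀ hv₀' (numerator_bracket s hN₁ hb hab hq₁) hcmp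
      (denominator_bracket s hφ hN₀ hw hwins hv))

variable {μ} in
/-- **`hquotA` AGAINST THE RECEIVER INSERT FROM THE TWO BRACKETS** (Card 64's edition): brackets against the WINDOW `win`
plus the NESTING `win ≤ B′·r` on the branch ((1.89): the window lives inside the receiver's small-field fibre) give `hquotA` on
the refined pair `(φ·a, φ·r)` against the RECEIVER insert, `q = (q₁∕v₀)·B′` — `hq_of_brackets`, 38e `hq_receiver_of_window`,
38e `hq_of_branch`; the window lives only inside this proof. [folklore] -/
theorem hquot_receiver_of_brackets (s : Finset ι) {φ N a b w win r : (∀ i, X i) → ℝ≥0∞} {q₁ v₀ B' : ℝ≥0∞}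
    (hφ : IndepOf s φ) (hN : IndepOf s N) (ha : Measurable a) (hb : Measurable b) (hw : Measurable w)
    (hr : Measurable r) (hab : ∀ V, a V ≤ N V * b V) (hq₁ : ∀ V, (∫⋯∫⁻_s, b ∂μ) V ≤ q₁)
    (hwwin : ∀ V, φ V ≠ 0 → N V * w V ≤ win V) (hv : ∀ V, φ V ≠ 0 → v₀ ≤ (∫⋯∫⁻_s, w ∂μ) V)
    (hv₀ : v₀ ≠ 0) (hv₀' : v₀ ≠ ⊤) (hdom : ∀ V, φ V ≠ 0 → win V ≤ B' * r V) :
    ∀ V, (∫⋯∫⁻_s, φ * a ∂μ) V ≤ q₁ / v₀ * B' * (∫⋯∫⁻_s, φ * r ∂μ) V :=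
  hq_of_branch s hφ ha hr
    (hq_receiver_of_window s hφ hr hdom
      (hq_of_brackets hv₀ hv₀' (numerator_bracket s hN hb hab hq₁) (denominator_bracket s hφ hN hw hwwin hv)))

end Junction

/-! ## §3  (own hand) THE CANCELLATION IN THE TOWER'S CURRENCY — Boltzmann brackets for `lmarginal` with an exterior-dependent background action -/

section ActionBrackets

variable {ι : Type*} [DecidableEq ι] {X : ι → Type*} [∀ i, MeasurableSpace (X i)] (μ : ∀ i, Measure (X i))

open Literature.MathematicalPhysics.QuantumFieldTheory.Balaban1983to89.B15.BasicStep

omit [∀ i, MeasurableSpace (X i)] in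
/-- an EXTERIOR-only real statistic (the background action reads no fibre coordinate) gives an exterior-only normaliser
`e^{−E₀}` in b01's sense. [textbook] -/
theorem indepOf_ofReal_exp_neg (s : Finset ι) {E₀ : (∀ i, X i) → ℝ}
    (hE₀ : ∀ (x : ∀ i, X i) (y : ∀ i : s, X i), E₀ (updateFinset x s y) = E₀ x) :
    IndepOf s (fun V => ENNReal.ofReal (Real.exp (-E₀ V))) := by
  intro x y
  simp only [hE₀ x y]

variable {μ} in
/-- **BOLTZMANN NUMERATOR BRACKET.**  `a ≤ e^{−f}·𝟙_S`, the CONSTRAINED ACTION GAP `E₀ V + G ≤ f V` on `S` relative to an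
exterior background action `E₀` (statement (1)), and fibre volumes of `S` `≤ vS` for every exterior give `numerator_bracket`'s
two hypotheses with `N = e^{−E₀}`, profile `b = e^{−G}·𝟙_S`, `q₁ = e^{−G}·vS`. [folklore] -/
theorem boltzmann_numerator_bracket (s : Finset ι) {S : Set (∀ i, X i)} (hS : MeasurableSet S)
    {a : (∀ i, X i) → ℝ≥0∞} {f E₀ : (∀ i, X i) → ℝ} {G : ℝ} {vS : ℝ≥0∞}
    (ha : ∀ V, a V ≤ ENNReal.ofReal (Real.exp (-f V)) * S.indicator 1 V)
    (hgap : ∀ V ∈ S, E₀ V + G ≤ f V)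
    (hvS : ∀ V, (∫⋯∫⁻_s, S.indicator 1 ∂μ) V ≤ vS) :
    (∀ V, a V ≤ ENNReal.ofReal (Real.exp (-E₀ V)) *
        (fun V => ENNReal.ofReal (Real.exp (-G)) * S.indicator 1 V) V) ∧
      ∀ V, (∫⋯∫⁻_s, (fun V => ENNReal.ofReal (Real.exp (-G)) * S.indicator 1 V) ∂μ) V
        ≤ ENNReal.ofReal (Real.exp (-G)) * vS := by
  refine ⟨fun V => ?_, fun V => ?_⟩
  · by_cases hV : V ∈ S
    · calc a V ≤ ENNReal.ofReal (Real.exp (-f V)) * S.indicator 1 V := ha V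
        _ ≤ ENNReal.ofReal (Real.exp (-(E₀ V + G))) * S.indicator 1 V := by
            gcongr
            exact hgap V hV
        _ = ENNReal.ofReal (Real.exp (-E₀ V)) * (ENNReal.ofReal (Real.exp (-G)) * S.indicator 1 V) := by
            rw [neg_add, Real.exp_add, ENNReal.ofReal_mul (Real.exp_pos _).le, mul_assoc]
    · exact (ha V).trans (by simp [hV])
  · have hc : IndepOf s (fun _ : (∀ i, X i) => ENNReal.ofReal (Real.exp (-G))) := fun _ _ => rfl
    have hmul : (fun V => ENNReal.ofReal (Real.exp (-G)) * S.indicator 1 V)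
        = (fun _ : (∀ i, X i) => ENNReal.ofReal (Real.exp (-G))) * S.indicator 1 := rfl
    rw [hmul, lmarginal_mul_of_indepOf s hc (measurable_one.indicator hS), Pi.mul_apply]
    gcongr; exact hvS V

variable {μ} in
/-- **BOLTZMANN DENOMINATOR BRACKET.**  `e^{−fI}·𝟙_W ≤ ins` ON THE BRANCH `{φ ≠ 0}`, the WINDOW ALLOWANCE `fI V ≤ E₀ V + η`
on `W` (statement (2)), and fibre volumes of `W` `≥ vW` on the branch give `denominator_bracket`'s two hypotheses with
`N = e^{−E₀}`, window profile `w = e^{−η}·𝟙_W`, `v₀ = e^{−η}·vW`. [folklore] -/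
theorem boltzmann_denominator_bracket (s : Finset ι) {W : Set (∀ i, X i)} (hW : MeasurableSet W)
    {φ ins : (∀ i, X i) → ℝ≥0∞} {fI E₀ : (∀ i, X i) → ℝ} {η : ℝ} {vW : ℝ≥0∞}
    (hins : ∀ V, φ V ≠ 0 → ENNReal.ofReal (Real.exp (-fI V)) * W.indicator 1 V ≤ ins V)
    (hall : ∀ V ∈ W, fI V ≤ E₀ V + η)
    (hvW : ∀ V, φ V ≠ 0 → vW ≤ (∫⋯∫⁻_s, W.indicator 1 ∂μ) V) :
    (∀ V, φ V ≠ 0 → ENNReal.ofReal (Real.exp (-E₀ V)) *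
        (fun V => ENNReal.ofReal (Real.exp (-η)) * W.indicator 1 V) V ≤ ins V) ∧
      ∀ V, φ V ≠ 0 → ENNReal.ofReal (Real.exp (-η)) * vW
        ≤ (∫⋯∫⁻_s, (fun V => ENNReal.ofReal (Real.exp (-η)) * W.indicator 1 V) ∂μ) V := by
  refine ⟨fun V hV => ?_, fun V hV => ?_⟩
  · by_cases hVW : V ∈ W
    · calc ENNReal.ofReal (Real.exp (-E₀ V)) * (ENNReal.ofReal (Real.exp (-η)) * W.indicator 1 V)
          = ENNReal.ofReal (Real.exp (-(E₀ V + η))) * W.indicator 1 V := by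
            rw [neg_add, Real.exp_add, ENNReal.ofReal_mul (Real.exp_pos _).le, mul_assoc]
        _ ≤ ENNReal.ofReal (Real.exp (-fI V)) * W.indicator 1 V := by
            gcongr
            exact hall V hVW
        _ ≤ ins V := hins V hV
    · simp [hVW]
  · have hc : IndepOf s (fun _ : (∀ i, X i) => ENNReal.ofReal (Real.exp (-η))) := fun _ _ => rfl
    have hmul : (fun V => ENNReal.ofReal (Real.exp (-η)) * W.indicator 1 V)
        = (fun _ : (∀ i, X i) => ENNReal.ofReal (Real.exp (-η))) * W.indicator 1 := rfl
    rw [hmul, lmarginal_mul_of_indepOf s hc (measurable_one.indicator hW), Pi.mul_apply]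
    gcongr; exact hvW V hV

/-- the constant after cancellation: `(e^{−G}·vS)·e^{β} ∕ (e^{−η}·vW) = e^{η+β−G}·(vS∕vW)`. [textbook] -/
theorem actionBrackets_const_eq (G η β : ℝ) (vS vW : ℝ≥0∞) :
    ENNReal.ofReal (Real.exp (-G)) * vS * ENNReal.ofReal (Real.exp β) / (ENNReal.ofReal (Real.exp (-η)) * vW)
      = ENNReal.ofReal (Real.exp (η + β - G)) * (vS / vW) := by
  have hη0 : ENNReal.ofReal (Real.exp (-η)) ≠ 0 := (ENNReal.ofReal_pos.mpr (Real.exp_pos _)).ne'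
  rw [show ENNReal.ofReal (Real.exp (-G)) * vS * ENNReal.ofReal (Real.exp β)
      = ENNReal.ofReal (Real.exp (-G)) * ENNReal.ofReal (Real.exp β) * vS by ring,
    ENNReal.mul_div_mul_comm (Or.inl hη0) (Or.inl ENNReal.ofReal_ne_top),
    ← ENNReal.ofReal_mul (Real.exp_pos _).le, ← Real.exp_add,
    ← ENNReal.ofReal_div_of_pos (Real.exp_pos _), ← Real.exp_sub]
  congr 3; ring

variable {μ} in
/-- **END-TO-END, TWO BACKGROUNDS: `hquotA` ON THE REFINED PAIR FROM TWO SUP-INEQUALITIES ON THE EFFECTIVE ACTION.**  Fibre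
coordinates `s` (38c's `O ∪ F s`); branch factor `φ` and background actions `E₁` (sender's, `A(U_{k,Z})∕g²`), `E₀` (receiver's,
`A(U₀)∕g²`) reading the exterior only; `a ≤ e^{−f}·𝟙_S` with the CONSTRAINED ACTION GAP `E₁ + G ≤ f` on `S` (statement (1));
`ins ≥ e^{−fI}·𝟙_W` on the branch with the WINDOW ALLOWANCE `fI ≤ E₀ + η` on `W` (statement (2)); `E₀ ≤ E₁ + β` on the branch
(statement (3), `B = e^β`); fibre volumes of `S` `≤ vS`, of `W` `≥ vW ∈ (0, ∞)` on the branch.  THEN, for EVERY exterior,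
`∫⋯∫⁻_s (φ·a) ≤ e^{η+β−G}·(vS∕vW)·∫⋯∫⁻_s (φ·ins)` — `E₀(V)`, `E₁(V)` NEVER enter the constant ([LF-II] p. 358). [folklore] -/
theorem hquot_of_actionBrackets_cmp (s : Finset ι) {S W : Set (∀ i, X i)} (hS : MeasurableSet S)
    (hW : MeasurableSet W) {φ a ins : (∀ i, X i) → ℝ≥0∞} {f fI E₀ E₁ : (∀ i, X i) → ℝ} {G η β : ℝ} {vS vW : ℝ≥0∞}
    (hφ : IndepOf s φ) (hE₀ : ∀ (x : ∀ i, X i) (y : ∀ i : s, X i), E₀ (updateFinset x s y) = E₀ x)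
    (hE₁ : ∀ (x : ∀ i, X i) (y : ∀ i : s, X i), E₁ (updateFinset x s y) = E₁ x) (ha : Measurable a)
    (hinsm : Measurable ins) (haS : ∀ V, a V ≤ ENNReal.ofReal (Real.exp (-f V)) * S.indicator 1 V)
    (hgap : ∀ V ∈ S, E₁ V + G ≤ f V) (hvS : ∀ V, (∫⋯∫⁻_s, S.indicator 1 ∂μ) V ≤ vS)
    (hinsW : ∀ V, φ V ≠ 0 → ENNReal.ofReal (Real.exp (-fI V)) * W.indicator 1 V ≤ ins V)
    (hall : ∀ V ∈ W, fI V ≤ E₀ V + η) (hcmp : ∀ V, φ V ≠ 0 → E₀ V ≤ E₁ V + β)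
    (hvW : ∀ V, φ V ≠ 0 → vW ≤ (∫⋯∫⁻_s, W.indicator 1 ∂μ) V) (hvW0 : vW ≠ 0) (hvWtop : vW ≠ ⊤) :
    ∀ V, (∫⋯∫⁻_s, φ * a ∂μ) V
      ≤ ENNReal.ofReal (Real.exp (η + β - G)) * (vS / vW) * (∫⋯∫⁻_s, φ * ins ∂μ) V := by
  obtain ⟨hab, hq₁⟩ := boltzmann_numerator_bracket (μ := μ) s hS haS hgap hvS
  obtain ⟨hwins, hv⟩ := boltzmann_denominator_bracket (μ := μ) s hW hinsW hall hvW
  have hv₀ : ENNReal.ofReal (Real.exp (-η)) * vW ≠ 0 :=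
    mul_ne_zero (ENNReal.ofReal_pos.mpr (Real.exp_pos _)).ne' hvW0
  have hv₀' : ENNReal.ofReal (Real.exp (-η)) * vW ≠ ⊤ := ENNReal.mul_ne_top ENNReal.ofReal_ne_top hvWtop
  have hNcmp : ∀ V, φ V ≠ 0 → ENNReal.ofReal (Real.exp (-E₁ V))
      ≤ ENNReal.ofReal (Real.exp β) * ENNReal.ofReal (Real.exp (-E₀ V)) := by
    intro V hV
    rw [← ENNReal.ofReal_mul (Real.exp_pos _).le, ← Real.exp_add]
    exact ENNReal.ofReal_le_ofReal (Real.exp_le_exp.mpr (by linarith [hcmp V hV]))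
  have key := hquot_of_brackets_cmp s hφ (indepOf_ofReal_exp_neg s hE₀) (indepOf_ofReal_exp_neg s hE₁) ha
    ((measurable_one.indicator hS).const_mul _) ((measurable_one.indicator hW).const_mul _) hinsm
    hab hq₁ hNcmp hwins hv hv₀ hv₀'
  intro V
  calc (∫⋯∫⁻_s, φ * a ∂μ) V
      ≤ ENNReal.ofReal (Real.exp (-G)) * vS * ENNReal.ofReal (Real.exp β)
          / (ENNReal.ofReal (Real.exp (-η)) * vW) * (∫⋯∫⁻_s, φ * ins ∂μ) V := key V
    _ = ENNReal.ofReal (Real.exp (η + β - G)) * (vS / vW) * (∫⋯∫⁻_s, φ * ins ∂μ) V := by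
        rw [actionBrackets_const_eq]

variable {μ} in
/-- **END-TO-END, ONE BACKGROUND** (`E₁ = E₀`, `β = 0`): `E₀ + G ≤ f` on the sender's support, `fI ≤ E₀ + η` on the window,
and the two fibre-volume bounds give 38c's `hquotA` on the refined pair with `q = e^{η−G}·(vS∕vW)`. [folklore] -/
theorem hquot_of_actionBrackets (s : Finset ι) {S W : Set (∀ i, X i)} (hS : MeasurableSet S)
    (hW : MeasurableSet W) {φ a ins : (∀ i, X i) → ℝ≥0∞} {f fI E₀ : (∀ i, X i) → ℝ} {G η : ℝ} {vS vW : ℝ≥0∞}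
    (hφ : IndepOf s φ) (hE₀ : ∀ (x : ∀ i, X i) (y : ∀ i : s, X i), E₀ (updateFinset x s y) = E₀ x)
    (ha : Measurable a) (hinsm : Measurable ins)
    (haS : ∀ V, a V ≤ ENNReal.ofReal (Real.exp (-f V)) * S.indicator 1 V) (hgap : ∀ V ∈ S, E₀ V + G ≤ f V)
    (hvS : ∀ V, (∫⋯∫⁻_s, S.indicator 1 ∂μ) V ≤ vS)
    (hinsW : ∀ V, φ V ≠ 0 → ENNReal.ofReal (Real.exp (-fI V)) * W.indicator 1 V ≤ ins V)
    (hall : ∀ V ∈ W, fI V ≤ E₀ V + η)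
    (hvW : ∀ V, φ V ≠ 0 → vW ≤ (∫⋯∫⁻_s, W.indicator 1 ∂μ) V) (hvW0 : vW ≠ 0) (hvWtop : vW ≠ ⊤) :
    ∀ V, (∫⋯∫⁻_s, φ * a ∂μ) V
      ≤ ENNReal.ofReal (Real.exp (η - G)) * (vS / vW) * (∫⋯∫⁻_s, φ * ins ∂μ) V := by
  have h := hquot_of_actionBrackets_cmp (μ := μ) s hS hW (β := 0) hφ hE₀ hE₀ ha hinsm haS hgap hvS hinsW hall
    (fun V _ => by simp) hvW hvW0 hvWtop
  simpa only [add_zero] using h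

end ActionBrackets

/-! ## §4  A6 WITNESS — §3's END theorem applied to one-coordinate toy data, every binder discharged in the kernel -/

/-- **A6 WITNESS** (director-ym STANDING A6 RULE №189 (3)): the binders of `hquot_of_actionBrackets` are simultaneously
satisfiable — one coordinate, Dirac reference law, `s = univ`, branch factor ∕ sender density ∕ insert `≡ 1`, actions and
background `≡ 0`, `G = η = 0`, `S = W = univ`, `vS = vW = 1`; the END theorem APPLIES. [folklore] -/
theorem actionBrackets_binders_inhabited :
    ∀ V : Unit → Unit,
      (∫⋯∫⁻_(Finset.univ : Finset Unit), (fun _ => (1 : ℝ≥0∞)) * (fun _ => (1 : ℝ≥0∞))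
          ∂(fun _ : Unit => Measure.dirac ())) V
        ≤ ENNReal.ofReal (Real.exp (0 - 0)) * (1 / 1) *
          (∫⋯∫⁻_(Finset.univ : Finset Unit), (fun _ => (1 : ℝ≥0∞)) * (fun _ => (1 : ℝ≥0∞))
            ∂(fun _ : Unit => Measure.dirac ())) V :=
  hquot_of_actionBrackets (μ := fun _ : Unit => Measure.dirac ()) (X := fun _ : Unit => Unit) Finset.univ
    (S := Set.univ) (W := Set.univ) MeasurableSet.univ MeasurableSet.univ
    (φ := fun _ => 1) (a := fun _ => 1) (ins := fun _ => 1) (f := fun _ => 0) (fI := fun _ => 0) (E₀ := fun _ => 0)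
    (G := 0) (η := 0) (vS := 1) (vW := 1)
    (fun _ _ => rfl) (fun _ _ => rfl) measurable_const measurable_const
    (fun V => by simp) (fun V _ => by simp) (fun V => by rw [lmarginal_univ]; simp) (fun V _ => by simp)
    (fun V _ => by simp) (fun V _ => by rw [lmarginal_univ]; simp) one_ne_zero ENNReal.one_ne_top

end Summit.QuantumFields.YangMills.Theorems.N21BranchQuotientBrackets
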